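import Literature.Analysis.FluidPDE.ElgindiEllipticVeryWeak
import Literature.Analysis.FluidPDE.ElgindiAngularMonomialModes
import HarnessLib

/-!
# The transpose polar operator on separated profiles `a(R)·cos²θ sinʲθ`
([Elgindi2021] §7.1: the adjoint angular problem, "`sin θcos²θ` is in the kernel of the adjoint
problem when `α = 0`")

Topic `Literature/Analysis/FluidPDE`. Proof file (everything proved, no definitions, no named
facts) on the proof path of the named fact
`Literature.Analysis.FluidPDE.Elgindi.ElgindiGhoulMasmoudi2021_stabilityCore`
(`ElgindiStabilityDecomposition.lean`). T. M. Elgindi, Ann. of Math. 194 (2021) =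
arXiv:1904.04795, §7.1 p. 19 of the held text ("sin(θ)cos²(θ) is in the kernel of the adjoint
problem when α = 0").

Companion of `ElgindiAngularMonomialModes.lean` for the formal transpose
`ᵗL(Φ) = −α²R²Φ_RR + (5α − 3α²)RΦ_R − Φ_θθ − tan θΦ_θ + (5α − α² − 6)Φ` (`transposeOp`): its
angular part `𝒜†u = −u″ − tan θ·u′` acts on the profiles `e_j = cos²θ sinʲθ` (which belong to the
test class `cos θ·χ`, `χ(R,0) = 0`, for odd `j`) by the same triangular rule as `𝒜` on `cos θ sinʲθ`:
`𝒜†(e_j) = (j+1)(j+2)e_j − j(j−1)cos²θ sin^{j−2}θ` (`transposeAngular_monomial`); for `j = 1`,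
`e₁ = K/3` and `(j+1)(j+2) = 6` recovers Elgindi's remark. Hence (`transposeOp_radial_mul_monomial`)
`ᵗL(a(R)e_j) = [−α²R²a″ + (5α−3α²)Ra′ + (5α−α²−6)a]e_j + a[(j+1)(j+2)e_j − j(j−1)e_{j−2}]`.
-/

noncomputable section

open MeasureTheory Set Real Filter Function
open _root_.Topology

namespace Literature.Analysis.FluidPDE

namespace Elgindi

/-- The first derivative of `e_j = cos²θ sinʲθ`: `e_j′ = j sin^{j−1}θ cos³θ − 2 sin^{j+1}θ cos θ`. [folklore] -/
theorem hasDerivAt_cosSq_monomial (j : ℕ) (θ : ℝ) :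
    HasDerivAt (fun θ => Real.cos θ ^ 2 * Real.sin θ ^ j)
      ((j : ℝ) * Real.sin θ ^ (j - 1) * Real.cos θ ^ 3 - 2 * Real.sin θ ^ (j + 1) * Real.cos θ) θ := by
  have hc2 : HasDerivAt (fun θ => Real.cos θ ^ 2) (2 * Real.cos θ * -Real.sin θ) θ := by
    have := (Real.hasDerivAt_cos θ).pow 2
    refine this.congr_deriv ?_
    simp
  have h := hc2.mul (hasDerivAt_sin_pow j θ)
  refine h.congr_deriv ?_
  have e : Real.sin θ ^ (j + 1) = Real.sin θ * Real.sin θ ^ j := by rw [pow_succ]; ring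
  rw [e]; ring

/-- **The transpose angular operator on `e_j = cos²θ sinʲθ`** (`j ≥ 1`, `cos θ ≠ 0`):
`−e_j″ − tan θ e_j′ = (j+1)(j+2)e_j − j(j−1)cos²θ sin^{j−2}θ`. [cite: Elgindi2021, §7.1 proof of Proposition 7.1, Step 1 (p. 19 of arXiv:1904.04795): "sin(θ)cos²(θ) is in the kernel of the adjoint problem when α = 0"] -/
theorem transposeAngular_monomial {j : ℕ} (hj : 1 ≤ j) {θ : ℝ} (hθ : Real.cos θ ≠ 0) :
    -deriv (deriv fun θ => Real.cos θ ^ 2 * Real.sin θ ^ j) θ - Real.tan θ * deriv (fun θ => Real.cos θ ^ 2 * Real.sin θ ^ j) θ =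
      ((j : ℝ) + 1) * ((j : ℝ) + 2) * (Real.cos θ ^ 2 * Real.sin θ ^ j) - (j : ℝ) * ((j : ℝ) - 1) * (Real.cos θ ^ 2 * Real.sin θ ^ (j - 2)) := by
  have e1 : deriv (fun θ => Real.cos θ ^ 2 * Real.sin θ ^ j) =
      fun θ => (j : ℝ) * Real.sin θ ^ (j - 1) * Real.cos θ ^ 3 - 2 * Real.sin θ ^ (j + 1) * Real.cos θ :=
    funext fun θ => (hasDerivAt_cosSq_monomial j θ).deriv
  have hc3 : HasDerivAt (fun θ => Real.cos θ ^ 3) (3 * Real.cos θ ^ 2 * -Real.sin θ) θ := by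
    have := (Real.hasDerivAt_cos θ).pow 3
    refine this.congr_deriv ?_
    simp
  have h2 : HasDerivAt (fun θ => (j : ℝ) * Real.sin θ ^ (j - 1) * Real.cos θ ^ 3 - 2 * Real.sin θ ^ (j + 1) * Real.cos θ)
      ((j : ℝ) * (((j - 1 : ℕ) : ℝ) * Real.sin θ ^ (j - 1 - 1) * Real.cos θ) * Real.cos θ ^ 3 +
        (j : ℝ) * Real.sin θ ^ (j - 1) * (3 * Real.cos θ ^ 2 * -Real.sin θ) -
        (2 * (((j + 1 : ℕ) : ℝ) * Real.sin θ ^ (j + 1 - 1) * Real.cos θ) * Real.cos θ + 2 * Real.sin θ ^ (j + 1) * -Real.sin θ)) θ := by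
    have a := ((hasDerivAt_sin_pow (j - 1) θ).const_mul (j : ℝ)).mul hc3
    have b := ((hasDerivAt_sin_pow (j + 1) θ).const_mul 2).mul (Real.hasDerivAt_cos θ)
    exact a.sub b
  rw [e1, h2.deriv]
  have ht : Real.tan θ * ((j : ℝ) * Real.sin θ ^ (j - 1) * Real.cos θ ^ 3 - 2 * Real.sin θ ^ (j + 1) * Real.cos θ) =
      Real.sin θ * ((j : ℝ) * Real.sin θ ^ (j - 1) * Real.cos θ ^ 2 - 2 * Real.sin θ ^ (j + 1)) := by
    rw [Real.tan_eq_sin_div_cos, div_mul_eq_mul_div, div_eq_iff hθ]; ring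
  rw [ht]
  have c1 : ((j - 1 : ℕ) : ℝ) = (j : ℝ) - 1 := by rw [Nat.cast_sub hj]; simp
  have c2 : ((j + 1 : ℕ) : ℝ) = (j : ℝ) + 1 := by push_cast; ring
  have ej : j + 1 - 1 = j := by omega
  have ej2 : j - 1 - 1 = j - 2 := by omega
  rw [c1, c2, ej, ej2]
  rcases Nat.lt_or_ge j 2 with hj1 | hj2
  · have hj' : j = 1 := by omega
    subst hj'
    simp
    ring
  · have p1 : Real.sin θ ^ j = Real.sin θ ^ (j - 2) * Real.sin θ ^ 2 := by
      rw [← pow_add]; congr 1; omega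
    have p2 : Real.sin θ ^ (j - 1) = Real.sin θ ^ (j - 2) * Real.sin θ := by
      rw [← pow_succ]; congr 1; omega
    have p3 : Real.sin θ ^ (j + 1) = Real.sin θ ^ (j - 2) * Real.sin θ ^ 3 := by
      rw [← pow_add]; congr 1; omega
    rw [p1, p2, p3]
    linear_combination (-((j : ℝ) * ((j : ℝ) - 1)) * Real.cos θ ^ 2 * Real.sin θ ^ (j - 2)) * Real.sin_sq_add_cos_sq θ

/-- **`ᵗL(a(R)·cos²θ sinʲθ) = [−α²R²a″ + (5α−3α²)Ra′ + (5α−α²−6)a]·e_j + a·[(j+1)(j+2)e_j − j(j−1)e_{j−2}]`**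
on the strip (`j ≥ 1`, `a ∈ C²`), `e_j = cos²θ sinʲθ`. [cite: Elgindi2021, §7.1 proof of Proposition 7.1, Step 1 (p. 19 of arXiv:1904.04795)] -/
theorem transposeOp_radial_mul_monomial (α : ℝ) {a : ℝ → ℝ} (ha : ContDiff ℝ 2 a) {j : ℕ} (hj : 1 ≤ j) {p : ℝ × ℝ} (hp : p ∈ strip) :
    transposeOp α (fun R θ => a R * (Real.cos θ ^ 2 * Real.sin θ ^ j)) p =
      (-α ^ 2 * p.1 ^ 2 * deriv (deriv a) p.1 + (5 * α - 3 * α ^ 2) * p.1 * deriv a p.1 + (5 * α - α ^ 2 - 6) * a p.1) *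
          (Real.cos p.2 ^ 2 * Real.sin p.2 ^ j) +
        a p.1 * ((((j : ℝ) + 1) * ((j : ℝ) + 2)) * (Real.cos p.2 ^ 2 * Real.sin p.2 ^ j) -
          (j : ℝ) * ((j : ℝ) - 1) * (Real.cos p.2 ^ 2 * Real.sin p.2 ^ (j - 2))) := by
  have hcos : Real.cos p.2 ≠ 0 := (Real.cos_pos_of_mem_Ioo ⟨by linarith [hp.2.1, Real.pi_pos], hp.2.2⟩).ne'
  set m : ℝ → ℝ := fun θ => Real.cos θ ^ 2 * Real.sin θ ^ j with hm
  have hda : Differentiable ℝ a := ha.differentiable (by norm_num)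
  have ha1 : ContDiff ℝ 1 (deriv a) := by have := ha.iterate_deriv' 1 1; simpa using this
  have hda' : Differentiable ℝ (deriv a) := ha1.differentiable (by norm_num)
  have hdm : Differentiable ℝ m := fun θ => (hasDerivAt_cosSq_monomial j θ).differentiableAt
  have dz1 : ∀ R θ, dz (fun R θ => a R * m θ) R θ = deriv a R * m θ := fun R θ => by
    show deriv (fun R' => a R' * m θ) R = _
    rw [deriv_mul_const (hda R)]
  have dz2 : dz (dz fun R θ => a R * m θ) p.1 p.2 = deriv (deriv a) p.1 * m p.2 := by
    have e : dz (fun R θ => a R * m θ) = fun R θ => deriv a R * m θ := by funext R θ; exact dz1 R θ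
    rw [e]
    show deriv (fun R' => deriv a R' * m p.2) p.1 = _
    rw [deriv_mul_const (hda' p.1)]
  have dθ1 : dθ (fun R θ => a R * m θ) = fun R θ => a R * deriv m θ := by
    funext R θ
    show deriv (fun θ' => a R * m θ') θ = _
    rw [deriv_const_mul _ (hdm θ)]
  have dθ2 : dθ (dθ fun R θ => a R * m θ) p.1 p.2 = a p.1 * deriv (deriv m) p.2 := by
    rw [dθ1]
    show deriv (fun θ' => a p.1 * deriv m θ') p.2 = _
    have hdm' : DifferentiableAt ℝ (deriv m) p.2 := by
      have e1 : deriv m = fun θ => (j : ℝ) * Real.sin θ ^ (j - 1) * Real.cos θ ^ 3 - 2 * Real.sin θ ^ (j + 1) * Real.cos θ :=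
        funext fun θ => (hasDerivAt_cosSq_monomial j θ).deriv
      rw [e1]; fun_prop
    rw [deriv_const_mul _ hdm']
  rw [transposeOp_apply, dz2, dz1, dθ2, dθ1]
  have hA := transposeAngular_monomial hj hcos (θ := p.2)
  simp only [hm] at hA ⊢
  have : a p.1 * (-deriv (deriv fun θ => Real.cos θ ^ 2 * Real.sin θ ^ j) p.2 - Real.tan p.2 * deriv (fun θ => Real.cos θ ^ 2 * Real.sin θ ^ j) p.2) =
      a p.1 * (((j : ℝ) + 1) * ((j : ℝ) + 2) * (Real.cos p.2 ^ 2 * Real.sin p.2 ^ j) - (j : ℝ) * ((j : ℝ) - 1) * (Real.cos p.2 ^ 2 * Real.sin p.2 ^ (j - 2))) := by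
    rw [hA]
  linear_combination this

end Elgindi

end Literature.Analysis.FluidPDE
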